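import Summits.NavierStokesRegularity.FunctionalMining.StretchingLowerCellularIntegrals
import Mathlib.Analysis.Fourier.AddCircle
import HarnessLib

/-!
# K1-Q1 laminate step, part 2: functions of an INTEGER DIRECTION `x ↦ P(k·x)` on `T³`

Cell `pub-nsfunc` (host summit NavierStokesRegularity, topic `FunctionalMining`), prove seat gen 6, for the
`LaminateStep` node (dict BLUEPRINT §1(a), §5: the certified lamination trees use GENERAL rational normals, so
the laminate profile is a function of `k·x = ∑ⱼ kⱼ xⱼ` for an arbitrary `k ∈ ℤ³ ∖ {0}`).
**Search for candidate a priori estimates; no regularity claim.** Torus calculus only.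

* `dirForm k x = ∑ⱼ kⱼ • xⱼ : T¹`, `dirFun k P x = P(k·x)`; smooth, `∂ⱼ P(k·x) = kⱼ P'(k·x)`
  (`partialDeriv_dirFun`), values represented by a real parameter (`exists_dirFun_eq`).
* **Lemma D** (`map_dirForm_volume`, `integral_comp_dirForm`, `integral_dirFun_comp`): for `k ≠ 0` the
  homomorphism `x ↦ k·x : T³ → T¹` pushes Haar measure to Haar measure (left invariance of the image of a
  surjective homomorphism + uniqueness of the Haar probability measure), hence
  `∫_{T³} Q(P(k·x)) dx = ∫₀¹ Q(P(t)) dt`.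
-/

noncomputable section

open MeasureTheory Set Filter Topology Function UnitAddTorus
open scoped ContDiff

namespace Summit.NavierStokesRegularity.FunctionalMining

open Literature.Analysis Literature.Analysis.FunctionSpaces Literature.Analysis.FunctionSpaces.Torus

namespace LaminateDirection

variable (k : Fin 3 → ℤ)

/-! ## 1. The direction form and functions of it -/

/-- The direction form `x ↦ k·x = ∑ⱼ kⱼ • xⱼ ∈ T¹` of an integer vector `k`. [ours; bookkeeping] -/
def dirForm (x : UnitAddTorus (Fin 3)) : UnitAddCircle := ∑ j, k j • x j

/-- `x ↦ P(k·x)` for a smooth `1`-periodic profile `P`. [ours; bookkeeping] -/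
def dirFun (P : ShearProfile) (x : UnitAddTorus (Fin 3)) : ℝ := P.onCircle (dirForm k x)

/-- The direction form on the covering space: `k·proj z = [∑ⱼ kⱼ zⱼ]`. [folklore] -/
theorem dirForm_proj (z : EuclideanSpace ℝ (Fin 3)) :
    dirForm k (proj z) = (((∑ j, (k j : ℝ) * z j : ℝ)) : UnitAddCircle) := by
  simp only [dirForm, Fin.sum_univ_three, proj_apply, ← AddCircle.coe_zsmul, ← AddCircle.coe_add, zsmul_eq_mul]

/-- Values on the covering space: `dirFun k P (proj z) = P(∑ⱼ kⱼ zⱼ)`. [folklore] -/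
theorem dirFun_proj (P : ShearProfile) (z : EuclideanSpace ℝ (Fin 3)) :
    dirFun k P (proj z) = P (∑ j, (k j : ℝ) * z j) := by
  rw [dirFun, dirForm_proj, ShearProfile.onCircle_coe]

/-- Every point of `T³` has a real representative of `k·x`, uniformly for all profiles. [folklore] -/
theorem exists_dirFun_eq (x : UnitAddTorus (Fin 3)) : ∃ t : ℝ, ∀ P : ShearProfile, dirFun k P x = P t := by
  obtain ⟨z, rfl⟩ := proj_surjective x
  exact ⟨∑ j, (k j : ℝ) * z j, fun P => dirFun_proj k P z⟩

/-- `x ↦ P(k·x)` is smooth. [folklore] -/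
theorem isSmooth_dirFun (P : ShearProfile) : IsSmooth (dirFun k P) := by
  unfold IsSmooth lift
  have : (dirFun k P ∘ proj) = fun z : EuclideanSpace ℝ (Fin 3) => P (∑ j, (k j : ℝ) * z j) := by
    funext z; exact dirFun_proj k P z
  rw [this]
  exact P.contDiff.comp (ContDiff.sum fun j _ => contDiff_const.mul (EuclideanSpace.proj j : EuclideanSpace ℝ (Fin 3) →L[ℝ] ℝ).contDiff)

/-- `C¹` bookkeeping. [folklore] -/
theorem isContDiff_dirFun (P : ShearProfile) : IsContDiff 1 (dirFun k P) :=
  (isSmooth_dirFun k P).isContDiff (by simp)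

/-- Continuity bookkeeping. [folklore] -/
theorem continuous_dirFun (P : ShearProfile) : Continuous (dirFun k P) := (isSmooth_dirFun k P).continuous

/-- **Partial derivatives of `P(k·x)`**: `∂ⱼ = kⱼ · P'(k·x)`. [folklore] -/
theorem partialDeriv_dirFun (P : ShearProfile) (j : Fin 3) (x : UnitAddTorus (Fin 3)) :
    Torus.partialDeriv j (dirFun k P) x = (k j : ℝ) * dirFun k P.D x := by
  obtain ⟨z, rfl⟩ := proj_surjective x
  unfold Torus.partialDeriv Torus.lineDeriv
  have harg : ∀ t : ℝ, proj z + proj (t • EuclideanSpace.single j (1 : ℝ)) =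
      proj (z + t • EuclideanSpace.single j 1) := fun t => (proj_add _ _).symm
  simp_rw [harg, dirFun_proj, ShearProfile.D_apply]
  have hfun : (fun t : ℝ => P (∑ i, (k i : ℝ) * (z + t • EuclideanSpace.single j (1 : ℝ)) i)) =
      fun t => P ((∑ i, (k i : ℝ) * z i) + t * (k j : ℝ)) := by
    funext t
    congr 1
    fin_cases j <;> simp [Fin.sum_univ_three] <;> ring
  rw [hfun, CellularStretching.deriv_comp_affine]

/-- Range bookkeeping: if `P` takes values in `[0,1]` then so does `P(k·x)`. [folklore] -/
theorem dirFun_mem {P : ShearProfile} (hP : ∀ t, P t ∈ Icc (0 : ℝ) 1) (x : UnitAddTorus (Fin 3)) :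
    dirFun k P x ∈ Icc (0 : ℝ) 1 := by
  obtain ⟨t, ht⟩ := exists_dirFun_eq k x
  rw [ht P]; exact hP t

/-- Sup-bound bookkeeping: `|P| ≤ K` everywhere gives `|P(k·x)| ≤ K`. [folklore] -/
theorem abs_dirFun_le {P : ShearProfile} {K : ℝ} (hP : ∀ t, |P t| ≤ K) (x : UnitAddTorus (Fin 3)) :
    |dirFun k P x| ≤ K := by
  obtain ⟨t, ht⟩ := exists_dirFun_eq k x
  rw [ht P]; exact hP t

/-! ## 2. Lemma D: `x ↦ k·x` pushes Haar measure on `T³` to Haar measure on `T¹` (`k ≠ 0`) -/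

/-- The direction form as a homomorphism `T³ →+ T¹`. [folklore] -/
def dirHom : UnitAddTorus (Fin 3) →+ UnitAddCircle where
  toFun := dirForm k
  map_zero' := by simp [dirForm]
  map_add' := fun x y => by simp [dirForm, Finset.sum_add_distrib]

/-- The direction form is continuous. [folklore] -/
theorem continuous_dirForm : Continuous (dirForm k) := by
  unfold dirForm
  exact continuous_finsetSum _ fun j _ => (continuous_zsmul (k j)).comp (continuous_apply j)

variable {k}

/-- For `k ≠ 0` the direction form is onto (the circle is divisible). [folklore] -/
theorem dirForm_surjective (hk : k ≠ 0) : Surjective (dirForm k) := by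
  obtain ⟨j₀, hj₀⟩ : ∃ j, k j ≠ 0 := by
    by_contra h
    exact hk (funext fun j => not_not.1 (not_exists.1 h j))
  intro y
  induction y using QuotientAddGroup.induction_on with
  | H t =>
    refine ⟨Pi.single j₀ (((t / k j₀ : ℝ)) : UnitAddCircle), ?_⟩
    have hkr : (k j₀ : ℝ) ≠ 0 := by exact_mod_cast hj₀
    simp only [dirForm]
    rw [Finset.sum_eq_single j₀ (fun j _ hj => by rw [Pi.single_eq_of_ne hj, zsmul_zero])
      (fun h => absurd (Finset.mem_univ _) h), Pi.single_eq_same, ← AddCircle.coe_zsmul, zsmul_eq_mul,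
      mul_div_cancel₀ _ hkr]

/-- **Lemma D (measure form)**: for `k ≠ 0`, the image of Haar measure on `T³` under `x ↦ k·x` is Haar
measure on `T¹`. [folklore] -/
theorem map_dirForm_volume (hk : k ≠ 0) :
    Measure.map (dirForm k) (volume : Measure (UnitAddTorus (Fin 3))) = volume := by
  have hmeas : Measurable (dirForm k) := (continuous_dirForm k).measurable
  haveI : (volume : Measure (UnitAddTorus (Fin 3))).IsAddLeftInvariant := by rw [volume_pi]; infer_instance
  haveI h1 : (Measure.map (dirForm k) (volume : Measure (UnitAddTorus (Fin 3)))).IsAddLeftInvariant :=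
    isAddLeftInvariant_map (dirHom k).toAddHom hmeas (dirForm_surjective hk)
  haveI h2 : IsProbabilityMeasure (Measure.map (dirForm k) (volume : Measure (UnitAddTorus (Fin 3)))) :=
    Measure.isProbabilityMeasure_map hmeas.aemeasurable
  rw [Measure.addHaarMeasure_unique (Measure.map (dirForm k) volume) ⊤, TopologicalSpace.PositiveCompacts.coe_top,
    measure_univ, one_smul, AddCircle.volume_eq_smul_haarAddCircle, ENNReal.ofReal_one, one_smul]
  rfl

/-- **Lemma D (integral form)**: `∫_{T³} F(k·x) dx = ∫_{T¹} F` for `k ≠ 0`. [folklore] -/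
theorem integral_comp_dirForm (hk : k ≠ 0) {F : UnitAddCircle → ℝ} (hF : AEStronglyMeasurable F volume) :
    ∫ x, F (dirForm k x) = ∫ y, F y := by
  have hmeas : Measurable (dirForm k) := (continuous_dirForm k).measurable
  have hF' : AEStronglyMeasurable F (Measure.map (dirForm k) (volume : Measure (UnitAddTorus (Fin 3)))) := by
    rw [map_dirForm_volume hk]; exact hF
  have h := integral_map (μ := (volume : Measure (UnitAddTorus (Fin 3)))) hmeas.aemeasurable hF'
  rw [map_dirForm_volume hk] at h
  exact h.symm

/-- **Lemma D for profiles**: `∫_{T³} Q(P(k·x)) dx = ∫₀¹ Q(P(t)) dt` for continuous `Q` and `k ≠ 0`. [folklore] -/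
theorem integral_dirFun_comp (hk : k ≠ 0) (P : ShearProfile) {Q : ℝ → ℝ} (hQ : Continuous Q) :
    ∫ x, Q (dirFun k P x) = ∫ t in (0 : ℝ)..1, Q (P t) := by
  have hc : Continuous fun y => Q (P.onCircle y) := hQ.comp P.continuous_onCircle
  unfold dirFun
  rw [integral_comp_dirForm hk (F := fun y => Q (P.onCircle y)) hc.aestronglyMeasurable,
    CellularStretching.integral_circle_eq_intervalIntegral]
  simp only [ShearProfile.onCircle_coe]

/-- Period integrals of powers: `∫_{T³} P(k·x)^p dx = ∫₀¹ P^p`. [folklore] -/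
theorem integral_dirFun_pow (hk : k ≠ 0) (P : ShearProfile) (p : ℕ) :
    ∫ x, dirFun k P x ^ p = ∫ t in (0 : ℝ)..1, P t ^ p :=
  integral_dirFun_comp hk P (continuous_id.pow p)

/-- **Two-scale envelope integrals**: `∫ E(x)^p · H(m•x)`-type products are integrable (bookkeeping for the
two-scale lemma). [folklore] -/
theorem continuous_dirFun_pow_mul {P : ShearProfile} (p : ℕ) {H : UnitAddTorus (Fin 3) → ℝ} (hH : Continuous H)
    (m : ℕ) : Continuous fun x => dirFun k P x ^ p * H (m • x) :=
  ((continuous_dirFun k P).pow p).mul (hH.comp (continuous_nsmul m))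

end LaminateDirection

end Summit.NavierStokesRegularity.FunctionalMining

end
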